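/-
Copyright (c) 2026 the pub-hodgecm-mathlib formalisation cell (harness21).  Prover seat hodgecm-mathlib-K2E4-p11 (g4), Track B ∕ K2-LIT, h413 =
`stmt-HodgeConjecture-24833`, line `K2_E1_TraceFormulaBeta`, campaign «EIS-RANK-ONE», deck #6 (q8) = (D5-b), deal D-Q8 of K2E1-plan (g5) 2026-09-04T08:11:34Z
(DEALS memo fe56b7cd5d935977 §D-Q8): THE ARCHIMEDEAN SMOOTHNESS BINDER `hφarch` OF ★ p857800 ∕ ★ p857911 FOR A `K_∞`-FINITE FLAT SECTION OF `U(1,1)` — hypothesis-first: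
`hφarch` follows from an ORDER-ZERO SYMBOL bound for `φ` along the archimedean line (Leibniz against the spherical envelope `H^{Re z}`); the tensor socket for products of
one-variable angular symbols; the `K_∞`-spherical finite-type case.
-/
import Summits.HodgeConjecture.HodgeConjecture.Theorems.K2E1HeightLineArchSmoothUniformU2   -- ★ (q11)₂ p858256 (K2E4-p10 (g4)); brings ★ (a3)₂ p858035, ★ (a3)₃ §1 explicit Leibniz, ★ `K2E1TensorSymbolProduct`, ★ (a2)₂
import HarnessLib

/-!
# h413 ∕ Track B «K2-LIT», «EIS-RANK-ONE» (q8) = (D5-b) — `K2E1KFiniteArchSmoothU2`: `hφarch` for `f_z = φ·H^z` on `U(1,1)` from an order-zero line symbol bound on `φ`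
# (the `K_∞`-finite reduction), the tensor socket for angular symbols, and the `K_∞`-spherical finite-type case

Cell `pub/hodgecm-mathlib`, crux H413 = `stmt-HodgeConjecture-24833`, route `HCCMUnconditional`; dealer K2E1-plan (g5), deal D-Q8 08:11:34Z; REPORT-FIRST 08:14Z (currency verdict:
neither ★ `UnitaryGroupBorelInduction` (LOCAL `p`-adic principal series) nor ★ `UnitaryGroupArchCharacter` (`(𝔤,K)`-class characters of `U(2,1)`) types an adelic `K_∞`-finite flat
section of `U(1,1)`; road (α) hypothesis-first).  THEOREMS ONLY (no `def`, no `instance`, no `notation`, no named-fact `def … : Prop`, no `sorry`); lane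
`--kind proof --supports stmt-HodgeConjecture-24833 --as helper` (count-neutral).
THE MATHEMATICS ([MoeglinWaldspurger1995, I.2.10–I.2.12]: smooth `K`-finite sections have symbol-type growth).  Letters of ★ (a3)₂: `G = U(J₂)` over the CM pair `(L⁺, L)`,
`ι(w₀) = weylLongU`, `n = middleRootUnipotent hij hN`, `θ = traceZeroLine`, `ι = ringEquiv_mixedSpace L⁺`, `K_U` the standard maximal compact, `f_z = flatSectionU φ z = φ·H^z`.
At a place `w ∣ ∞` of `L` (complex), `K_w = U(2) ∩ U(1,1)_w ≅ U(1)²` is ABELIAN, its types are characters `(p, q) ∈ ℤ²`, and a weight-`(p,q)` section restricts to the big-cell line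
`s ↦ ι(w₀)·n(θ(ι⁻¹s, b))·k` (last row `(1, i·(wδ)·s_w)`, ★ (a2)₂) as `φ₀(b,k) · ∏_w u_w(s_w)` with ONE-VARIABLE ANGULAR SYMBOLS `u_w` of ORDER ZERO (`u_w = ±e^{i(p−q)arctan((wδ)s)}`,
all derivatives bounded).  Hence the line function of `φ` has bounded derivatives (`hφsym`, this file's input binder), and Leibniz against the spherical section `1·H^z`
(★ (a3)₂: `‖Dʲ‖ ≤ C_H·H^{Re z}`) gives `hφarch` for `f_z = φ·H^z` with `C_φ = 2^m·M_φ·C_H`.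
* §1 **`exists_archSmooth_flatSectionU_of_lineSymbol_cm_two (hcδ hδ) (z) (m) (hMφ) (hφsym)`** : `∃ C_φ ≥ 0, hφarch[f := flatSectionU φ z]` — the binder of ★ p857911
  `exists_bound_sub_borelConstantTerm_level_cm_two_of_archSmooth` ∕ ★ `…ArchCMTwo` VERBATIM, for ANY `φ` with an order-zero line symbol bound `hφsym`; and its `‖z‖ ≤ R`-UNIFORM twin
  **`exists_archSmooth_flatSectionU_of_lineSymbol_cm_two_uniform`** (★ (q11)₂ road) for the (R3u)₂ ∕ W5 consumers.
* §2 **`lineSymbol_of_prod_angular`** — the tensor socket: if along the line `φ(ι(w₀)·n(θ(ι⁻¹s,b))·k) = φ₀(b,k)·∏_w u_w(s_{w|L⁺})` with `‖φ₀(b,k)‖ ≤ M` and `C^m` angular symbols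
  `‖u_w⁽ʲ⁾‖ ≤ M_u` (`j ≤ m`), then `hφsym` holds with `M_φ = M·(2^m M_u)^{#w}` (★ (a3)₃ `norm_iteratedFDeriv_finset_prod_le_explicit`, ★ `norm_iteratedFDeriv_comp_form_le`).
* §3 **`lineSymbol_of_archConstant`** — the `K_∞`-SPHERICAL FINITE-TYPE case: `φ` constant along the archimedean line (e.g. `φ` factoring through `g_f`), `‖φ‖ ≤ M` ⟹ `hφsym` with
  `M_φ = M`; so ★ (a3)₂ (`φ ≡ φ₀`) extends to every finite-type section spherical at `∞`.
* §4 **`angularPow_contDiff_and_exists_norm_iteratedDeriv_le (hc : c ≠ 0) (n m)`** — a CONCRETE angular symbol of order zero: `v_c(s)ⁿ`, `v_c(s) = (1 + i c s)(1 + c²s²)^{−1/2}`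
  (`|v_c| = 1`, `norm_angular_eq_one`; `= e^{i n·arctan(cs)}`, the line value of a weight with `p − q = n`): `C^m` with ALL derivatives of order `≤ m` bounded by one `C(c,n,m)` (Leibniz with
  envelopes `√(1+c²s²)` and `(1+c²s²)^{−1/2}` — ★ (a1) `exists_norm_iteratedFDeriv_le` — then ★ (a3)₃ for the power).
THE ONE INPUT NOT ★ (named, road (α)): (I-τ) «a weight-`τ` section restricts to the line as in §2» — the archimedean last-row ∕ Iwasawa computation of the angular factor
`ang_w(g) = ((r₀+r₁)∕‖r‖)^p((r₁−r₀)∕‖r‖)^q`, `r = (lastRow g)_w`; it needs the FUNCTION `ang_w` on `G(𝔸)` (a `def`: DEFS LEAF (D5-b′) `K2E1KTypeAngularSectionU2Defs`, to be dealt),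
whose line value plugs §2 and discharges (I-τ).
HONEST LABEL.  Count-neutral helper; proves no printed statement; HC_CM is proved only modulo the 7 printed citations (2 remaining named inputs: hLiu418 =
`stmt-HodgeConjecture-24832`, h413 = `stmt-HodgeConjecture-24833`) until rung 0 closes.

## References
* [MoeglinWaldspurger1995] C. Mœglin, J.-L. Waldspurger, *Spectral decomposition and Eisenstein series* (1995), I.2.10–I.2.12 (growth of smooth `K`-finite sections), II.1.5.
* [HormanderALPDO1] L. Hörmander, *The Analysis of Linear Partial Differential Operators I* (1983), §7.1 (symbols; products).
* [Garrett2018] P. Garrett, *Modern Analysis of Automorphic Forms by Example* 1 (2018), §2.2 (Iwasawa coordinates on the big cell), §12.2.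
-/

set_option autoImplicit false
set_option linter.dupNamespace false  -- the mandated namespace repeats the summit's segment (`HodgeConjecture.HodgeConjecture`)

noncomputable section

open NumberField NumberField.InfinitePlace NumberField.mixedEmbedding IsDedekindDomain
open Literature.NumberTheory.Automorphic Literature.NumberTheory.Automorphic.UnitaryGroup AdelicGroupData
open Summit.HodgeConjecture.HodgeConjecture.Cruxes.H413.K2E1BorelEisensteinU
open Summit.HodgeConjecture.HodgeConjecture.Cruxes.H413.K2E1HeightBigCellLineFormulaU2
open Summit.HodgeConjecture.HodgeConjecture.Cruxes.H413.K2E1TensorSymbolProduct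
open Summit.HodgeConjecture.HodgeConjecture.Cruxes.H413.K2E1HeightLineArchSmoothU2 (exists_archSmooth_flatSectionU_const_cm_two norm_proj_comp_fst_le_one)
open Summit.HodgeConjecture.HodgeConjecture.Cruxes.H413.K2E1HeightLineArchSmoothUniformU2 (exists_archSmooth_flatSectionU_const_cm_two_uniform)
open Summit.HodgeConjecture.HodgeConjecture.Cruxes.H413.K2E1HeightLineArchSmoothU3 (norm_iteratedFDeriv_finset_prod_le_explicit)
-- `Classical` is needed to see the Mathlib normed-space instances on `mixedSpace` (note H5 of `AdelicGLnGlue`)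
open scoped NNReal ContDiff Classical

namespace Summit.HodgeConjecture.HodgeConjecture.Cruxes.H413.K2E1KFiniteArchSmoothU2

variable (L : Type) [Field L] [NumberField L] [IsCMField L]
  (hij : (((0 : Fin 2) : ℕ)) + 1 = ((1 : Fin 2) : ℕ)) (hN : 2 = 2 * ((0 : Fin 2) : ℕ) + 2)

/-! ## §1 `hφarch` for `f_z = φ·H^z` from an order-zero line symbol bound on `φ` -/

section Leibniz

/-- **(q8) — THE `K_∞`-FINITE REDUCTION: `hφarch` FOR `f_z = φ·H^z` FROM AN ORDER-ZERO SYMBOL BOUND ON `φ` ALONG THE ARCHIMEDEAN LINE.**  Let `δ ∈ L⁻ ∖ 0`, `z ∈ ℂ`, `m ∈ ℕ`,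
`φ : G(𝔸) → ℂ`, `M_φ ≥ 0`, and suppose (`hφsym`) that for every `k ∈ K_U` and `b ∈ 𝔸_{L⁺}^∞` the line function `(a ↦ φ(ι(w₀)·n(θ(a,b))·k)) ∘ ι⁻¹` is `C^m` on `mixedSpace L⁺` with
`‖Dʲ(…)(s)‖ ≤ M_φ` (`j ≤ m`).  Then there is `C_φ ≥ 0` (`= 2^m·M_φ·C_H`, `C_H` the constant of ★ (a3)₂ at `φ₀ = 1`) with the binder `hφarch` of ★ p857911 ∕ ★ `…ArchCMTwo` for
`f_z = flatSectionU φ z` VERBATIM: `C^m` and `‖Dʲ(…)(s)‖ ≤ C_φ·H(ι(w₀)·n(θ(ι⁻¹s, b))·k)^{Re z}`.  Proof: `f_z = φ · (1·H^z)` pointwise along the line; Leibniz ★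
`norm_iteratedFDeriv_mul_le_of_envelopes` with envelopes `1` and `H^{Re z}`. [cite: MoeglinWaldspurger1995, I.2.10–I.2.12, II.1.5] [cite: HormanderALPDO1, §7.1] -/
theorem exists_archSmooth_flatSectionU_of_lineSymbol_cm_two {δ : L} (hcδ : IsCMField.complexConj L δ = -δ) (hδ : δ ≠ 0) (z : ℂ) (m : ℕ)
    {φ : (quasiSplit (↥(maximalRealSubfield L)) L (IsCMField.complexConj L) 2).Adelic → ℂ} {Mφ : ℝ} (hMφ : 0 ≤ Mφ)
    (hφsym : ∀ k ∈ ((standardMaximalCompactGL 2 L).comap (adelicVal ↥(maximalRealSubfield L) L (IsCMField.complexConj L) 2 ((StdForm.antidiagonal 2).over L)) : Subgroup (quasiSplit (↥(maximalRealSubfield L)) L (IsCMField.complexConj L) 2).Adelic), ∀ b : FiniteAdeleRing (𝓞 ↥(maximalRealSubfield L)) ↥(maximalRealSubfield L),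
      ContDiff ℝ m ((fun a : InfiniteAdeleRing ↥(maximalRealSubfield L) => φ (((quasiSplit (↥(maximalRealSubfield L)) L (IsCMField.complexConj L) 2).toAdelic (weylLongU ((IsCMField.complexConj L : L ≃ₐ[↥(maximalRealSubfield L)] L) : L →+* L) (rfl : ((StdForm.antidiagonal 2).over L) = ((StdForm.antidiagonal 2).over L)))) *
          ((middleRootUnipotent hij hN (Multiplicative.ofAdd (traceZeroLine ↥(maximalRealSubfield L) L (IsCMField.complexConj L) hcδ hδ ((a, b) : AdeleRing (𝓞 ↥(maximalRealSubfield L)) ↥(maximalRealSubfield L)))) : ↥(adelicUnipotent ↥(maximalRealSubfield L) L (IsCMField.complexConj L) 2)) : (quasiSplit (↥(maximalRealSubfield L)) L (IsCMField.complexConj L) 2).Adelic) * k)) ∘ (InfiniteAdeleRing.ringEquiv_mixedSpace ↥(maximalRealSubfield L)).symm) ∧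
      ∀ j : ℕ, j ≤ m → ∀ s : mixedSpace ↥(maximalRealSubfield L), ‖iteratedFDeriv ℝ j ((fun a : InfiniteAdeleRing ↥(maximalRealSubfield L) => φ (((quasiSplit (↥(maximalRealSubfield L)) L (IsCMField.complexConj L) 2).toAdelic (weylLongU ((IsCMField.complexConj L : L ≃ₐ[↥(maximalRealSubfield L)] L) : L →+* L) (rfl : ((StdForm.antidiagonal 2).over L) = ((StdForm.antidiagonal 2).over L)))) *
          ((middleRootUnipotent hij hN (Multiplicative.ofAdd (traceZeroLine ↥(maximalRealSubfield L) L (IsCMField.complexConj L) hcδ hδ ((a, b) : AdeleRing (𝓞 ↥(maximalRealSubfield L)) ↥(maximalRealSubfield L)))) : ↥(adelicUnipotent ↥(maximalRealSubfield L) L (IsCMField.complexConj L) 2)) : (quasiSplit (↥(maximalRealSubfield L)) L (IsCMField.complexConj L) 2).Adelic) * k)) ∘ (InfiniteAdeleRing.ringEquiv_mixedSpace ↥(maximalRealSubfield L)).symm) s‖ ≤ Mφ) :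
    ∃ Cφ : ℝ, 0 ≤ Cφ ∧
    ∀ k ∈ ((standardMaximalCompactGL 2 L).comap (adelicVal ↥(maximalRealSubfield L) L (IsCMField.complexConj L) 2 ((StdForm.antidiagonal 2).over L)) : Subgroup (quasiSplit (↥(maximalRealSubfield L)) L (IsCMField.complexConj L) 2).Adelic), ∀ b : FiniteAdeleRing (𝓞 ↥(maximalRealSubfield L)) ↥(maximalRealSubfield L),
      ContDiff ℝ m ((fun a : InfiniteAdeleRing ↥(maximalRealSubfield L) => flatSectionU φ z (((quasiSplit (↥(maximalRealSubfield L)) L (IsCMField.complexConj L) 2).toAdelic (weylLongU ((IsCMField.complexConj L : L ≃ₐ[↥(maximalRealSubfield L)] L) : L →+* L) (rfl : ((StdForm.antidiagonal 2).over L) = ((StdForm.antidiagonal 2).over L)))) *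
          ((middleRootUnipotent hij hN (Multiplicative.ofAdd (traceZeroLine ↥(maximalRealSubfield L) L (IsCMField.complexConj L) hcδ hδ ((a, b) : AdeleRing (𝓞 ↥(maximalRealSubfield L)) ↥(maximalRealSubfield L)))) : ↥(adelicUnipotent ↥(maximalRealSubfield L) L (IsCMField.complexConj L) 2)) : (quasiSplit (↥(maximalRealSubfield L)) L (IsCMField.complexConj L) 2).Adelic) * k)) ∘ (InfiniteAdeleRing.ringEquiv_mixedSpace ↥(maximalRealSubfield L)).symm) ∧
      ∀ j : ℕ, j ≤ m → ∀ s : mixedSpace ↥(maximalRealSubfield L),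
        ‖iteratedFDeriv ℝ j ((fun a : InfiniteAdeleRing ↥(maximalRealSubfield L) => flatSectionU φ z (((quasiSplit (↥(maximalRealSubfield L)) L (IsCMField.complexConj L) 2).toAdelic (weylLongU ((IsCMField.complexConj L : L ≃ₐ[↥(maximalRealSubfield L)] L) : L →+* L) (rfl : ((StdForm.antidiagonal 2).over L) = ((StdForm.antidiagonal 2).over L)))) *
          ((middleRootUnipotent hij hN (Multiplicative.ofAdd (traceZeroLine ↥(maximalRealSubfield L) L (IsCMField.complexConj L) hcδ hδ ((a, b) : AdeleRing (𝓞 ↥(maximalRealSubfield L)) ↥(maximalRealSubfield L)))) : ↥(adelicUnipotent ↥(maximalRealSubfield L) L (IsCMField.complexConj L) 2)) : (quasiSplit (↥(maximalRealSubfield L)) L (IsCMField.complexConj L) 2).Adelic) * k)) ∘ (InfiniteAdeleRing.ringEquiv_mixedSpace ↥(maximalRealSubfield L)).symm) s‖ ≤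
          Cφ * (borelHeight (((quasiSplit (↥(maximalRealSubfield L)) L (IsCMField.complexConj L) 2).toAdelic (weylLongU ((IsCMField.complexConj L : L ≃ₐ[↥(maximalRealSubfield L)] L) : L →+* L) (rfl : ((StdForm.antidiagonal 2).over L) = ((StdForm.antidiagonal 2).over L)))) *
          ((middleRootUnipotent hij hN (Multiplicative.ofAdd (traceZeroLine ↥(maximalRealSubfield L) L (IsCMField.complexConj L) hcδ hδ (((InfiniteAdeleRing.ringEquiv_mixedSpace ↥(maximalRealSubfield L)).symm s, b) : AdeleRing (𝓞 ↥(maximalRealSubfield L)) ↥(maximalRealSubfield L)))) : ↥(adelicUnipotent ↥(maximalRealSubfield L) L (IsCMField.complexConj L) 2)) : (quasiSplit (↥(maximalRealSubfield L)) L (IsCMField.complexConj L) 2).Adelic) * k) : ℝ) ^ z.re := by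
  obtain ⟨C₁, hC₁0, hC₁⟩ := exists_archSmooth_flatSectionU_const_cm_two L hij hN hcδ hδ z 1 m
  refine ⟨2 ^ m * Mφ * C₁, by positivity, fun k hk b => ?_⟩
  obtain ⟨hφcd, hφb⟩ := hφsym k hk b
  obtain ⟨h1cd, h1b⟩ := hC₁ k hk b
  have hfun : ((fun a : InfiniteAdeleRing ↥(maximalRealSubfield L) => flatSectionU φ z (((quasiSplit (↥(maximalRealSubfield L)) L (IsCMField.complexConj L) 2).toAdelic (weylLongU ((IsCMField.complexConj L : L ≃ₐ[↥(maximalRealSubfield L)] L) : L →+* L) (rfl : ((StdForm.antidiagonal 2).over L) = ((StdForm.antidiagonal 2).over L)))) *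
          ((middleRootUnipotent hij hN (Multiplicative.ofAdd (traceZeroLine ↥(maximalRealSubfield L) L (IsCMField.complexConj L) hcδ hδ ((a, b) : AdeleRing (𝓞 ↥(maximalRealSubfield L)) ↥(maximalRealSubfield L)))) : ↥(adelicUnipotent ↥(maximalRealSubfield L) L (IsCMField.complexConj L) 2)) : (quasiSplit (↥(maximalRealSubfield L)) L (IsCMField.complexConj L) 2).Adelic) * k)) ∘ (InfiniteAdeleRing.ringEquiv_mixedSpace ↥(maximalRealSubfield L)).symm) =
      fun s => ((fun a : InfiniteAdeleRing ↥(maximalRealSubfield L) => φ (((quasiSplit (↥(maximalRealSubfield L)) L (IsCMField.complexConj L) 2).toAdelic (weylLongU ((IsCMField.complexConj L : L ≃ₐ[↥(maximalRealSubfield L)] L) : L →+* L) (rfl : ((StdForm.antidiagonal 2).over L) = ((StdForm.antidiagonal 2).over L)))) *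
          ((middleRootUnipotent hij hN (Multiplicative.ofAdd (traceZeroLine ↥(maximalRealSubfield L) L (IsCMField.complexConj L) hcδ hδ ((a, b) : AdeleRing (𝓞 ↥(maximalRealSubfield L)) ↥(maximalRealSubfield L)))) : ↥(adelicUnipotent ↥(maximalRealSubfield L) L (IsCMField.complexConj L) 2)) : (quasiSplit (↥(maximalRealSubfield L)) L (IsCMField.complexConj L) 2).Adelic) * k)) ∘ (InfiniteAdeleRing.ringEquiv_mixedSpace ↥(maximalRealSubfield L)).symm) s * ((fun a : InfiniteAdeleRing ↥(maximalRealSubfield L) => flatSectionU (fun _ : (quasiSplit (↥(maximalRealSubfield L)) L (IsCMField.complexConj L) 2).Adelic => (1 : ℂ)) z (((quasiSplit (↥(maximalRealSubfield L)) L (IsCMField.complexConj L) 2).toAdelic (weylLongU ((IsCMField.complexConj L : L ≃ₐ[↥(maximalRealSubfield L)] L) : L →+* L) (rfl : ((StdForm.antidiagonal 2).over L) = ((StdForm.antidiagonal 2).over L)))) *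
          ((middleRootUnipotent hij hN (Multiplicative.ofAdd (traceZeroLine ↥(maximalRealSubfield L) L (IsCMField.complexConj L) hcδ hδ ((a, b) : AdeleRing (𝓞 ↥(maximalRealSubfield L)) ↥(maximalRealSubfield L)))) : ↥(adelicUnipotent ↥(maximalRealSubfield L) L (IsCMField.complexConj L) 2)) : (quasiSplit (↥(maximalRealSubfield L)) L (IsCMField.complexConj L) 2).Adelic) * k)) ∘ (InfiniteAdeleRing.ringEquiv_mixedSpace ↥(maximalRealSubfield L)).symm) s := by
    funext s
    simp only [Function.comp_apply, flatSectionU_apply, one_mul]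
  refine ⟨by rw [hfun]; exact hφcd.mul h1cd, fun j hj s => ?_⟩
  rw [hfun]
  refine (norm_iteratedFDeriv_mul_le_of_envelopes (𝔸 := ℂ) (e₁ := fun _ => (1 : ℝ)) hφcd h1cd (le_refl _) hMφ hC₁0 (fun _ => zero_le_one)
    (fun _ => Real.rpow_nonneg (NNReal.coe_nonneg _) _) (fun j hj x => by rw [mul_one]; exact hφb j hj x) h1b hj s).trans (le_of_eq ?_)
  ring

/-- **(q8), UNIFORMLY ON `‖z‖ ≤ R`** — the same with ONE `C_φ` for all `‖z‖ ≤ R` (★ (q11)₂ `exists_archSmooth_flatSectionU_const_cm_two_uniform` at `φ₀ = 1`; `hφsym` does not see `z`):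
the shape the `z`-uniform consumers ((R3u)₂, W5) take. [cite: MoeglinWaldspurger1995, I.2.10–I.2.12, II.1.5] [cite: HormanderALPDO1, §7.1] -/
theorem exists_archSmooth_flatSectionU_of_lineSymbol_cm_two_uniform {δ : L} (hcδ : IsCMField.complexConj L δ = -δ) (hδ : δ ≠ 0) (m : ℕ) (R : ℝ)
    {φ : (quasiSplit (↥(maximalRealSubfield L)) L (IsCMField.complexConj L) 2).Adelic → ℂ} {Mφ : ℝ} (hMφ : 0 ≤ Mφ)
    (hφsym : ∀ k ∈ ((standardMaximalCompactGL 2 L).comap (adelicVal ↥(maximalRealSubfield L) L (IsCMField.complexConj L) 2 ((StdForm.antidiagonal 2).over L)) : Subgroup (quasiSplit (↥(maximalRealSubfield L)) L (IsCMField.complexConj L) 2).Adelic), ∀ b : FiniteAdeleRing (𝓞 ↥(maximalRealSubfield L)) ↥(maximalRealSubfield L),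
      ContDiff ℝ m ((fun a : InfiniteAdeleRing ↥(maximalRealSubfield L) => φ (((quasiSplit (↥(maximalRealSubfield L)) L (IsCMField.complexConj L) 2).toAdelic (weylLongU ((IsCMField.complexConj L : L ≃ₐ[↥(maximalRealSubfield L)] L) : L →+* L) (rfl : ((StdForm.antidiagonal 2).over L) = ((StdForm.antidiagonal 2).over L)))) *
          ((middleRootUnipotent hij hN (Multiplicative.ofAdd (traceZeroLine ↥(maximalRealSubfield L) L (IsCMField.complexConj L) hcδ hδ ((a, b) : AdeleRing (𝓞 ↥(maximalRealSubfield L)) ↥(maximalRealSubfield L)))) : ↥(adelicUnipotent ↥(maximalRealSubfield L) L (IsCMField.complexConj L) 2)) : (quasiSplit (↥(maximalRealSubfield L)) L (IsCMField.complexConj L) 2).Adelic) * k)) ∘ (InfiniteAdeleRing.ringEquiv_mixedSpace ↥(maximalRealSubfield L)).symm) ∧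
      ∀ j : ℕ, j ≤ m → ∀ s : mixedSpace ↥(maximalRealSubfield L), ‖iteratedFDeriv ℝ j ((fun a : InfiniteAdeleRing ↥(maximalRealSubfield L) => φ (((quasiSplit (↥(maximalRealSubfield L)) L (IsCMField.complexConj L) 2).toAdelic (weylLongU ((IsCMField.complexConj L : L ≃ₐ[↥(maximalRealSubfield L)] L) : L →+* L) (rfl : ((StdForm.antidiagonal 2).over L) = ((StdForm.antidiagonal 2).over L)))) *
          ((middleRootUnipotent hij hN (Multiplicative.ofAdd (traceZeroLine ↥(maximalRealSubfield L) L (IsCMField.complexConj L) hcδ hδ ((a, b) : AdeleRing (𝓞 ↥(maximalRealSubfield L)) ↥(maximalRealSubfield L)))) : ↥(adelicUnipotent ↥(maximalRealSubfield L) L (IsCMField.complexConj L) 2)) : (quasiSplit (↥(maximalRealSubfield L)) L (IsCMField.complexConj L) 2).Adelic) * k)) ∘ (InfiniteAdeleRing.ringEquiv_mixedSpace ↥(maximalRealSubfield L)).symm) s‖ ≤ Mφ) :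
    ∃ Cφ : ℝ, 0 ≤ Cφ ∧ ∀ z : ℂ, ‖z‖ ≤ R →
    ∀ k ∈ ((standardMaximalCompactGL 2 L).comap (adelicVal ↥(maximalRealSubfield L) L (IsCMField.complexConj L) 2 ((StdForm.antidiagonal 2).over L)) : Subgroup (quasiSplit (↥(maximalRealSubfield L)) L (IsCMField.complexConj L) 2).Adelic), ∀ b : FiniteAdeleRing (𝓞 ↥(maximalRealSubfield L)) ↥(maximalRealSubfield L),
      ContDiff ℝ m ((fun a : InfiniteAdeleRing ↥(maximalRealSubfield L) => flatSectionU φ z (((quasiSplit (↥(maximalRealSubfield L)) L (IsCMField.complexConj L) 2).toAdelic (weylLongU ((IsCMField.complexConj L : L ≃ₐ[↥(maximalRealSubfield L)] L) : L →+* L) (rfl : ((StdForm.antidiagonal 2).over L) = ((StdForm.antidiagonal 2).over L)))) *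
          ((middleRootUnipotent hij hN (Multiplicative.ofAdd (traceZeroLine ↥(maximalRealSubfield L) L (IsCMField.complexConj L) hcδ hδ ((a, b) : AdeleRing (𝓞 ↥(maximalRealSubfield L)) ↥(maximalRealSubfield L)))) : ↥(adelicUnipotent ↥(maximalRealSubfield L) L (IsCMField.complexConj L) 2)) : (quasiSplit (↥(maximalRealSubfield L)) L (IsCMField.complexConj L) 2).Adelic) * k)) ∘ (InfiniteAdeleRing.ringEquiv_mixedSpace ↥(maximalRealSubfield L)).symm) ∧
      ∀ j : ℕ, j ≤ m → ∀ s : mixedSpace ↥(maximalRealSubfield L),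
        ‖iteratedFDeriv ℝ j ((fun a : InfiniteAdeleRing ↥(maximalRealSubfield L) => flatSectionU φ z (((quasiSplit (↥(maximalRealSubfield L)) L (IsCMField.complexConj L) 2).toAdelic (weylLongU ((IsCMField.complexConj L : L ≃ₐ[↥(maximalRealSubfield L)] L) : L →+* L) (rfl : ((StdForm.antidiagonal 2).over L) = ((StdForm.antidiagonal 2).over L)))) *
          ((middleRootUnipotent hij hN (Multiplicative.ofAdd (traceZeroLine ↥(maximalRealSubfield L) L (IsCMField.complexConj L) hcδ hδ ((a, b) : AdeleRing (𝓞 ↥(maximalRealSubfield L)) ↥(maximalRealSubfield L)))) : ↥(adelicUnipotent ↥(maximalRealSubfield L) L (IsCMField.complexConj L) 2)) : (quasiSplit (↥(maximalRealSubfield L)) L (IsCMField.complexConj L) 2).Adelic) * k)) ∘ (InfiniteAdeleRing.ringEquiv_mixedSpace ↥(maximalRealSubfield L)).symm) s‖ ≤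
          Cφ * (borelHeight (((quasiSplit (↥(maximalRealSubfield L)) L (IsCMField.complexConj L) 2).toAdelic (weylLongU ((IsCMField.complexConj L : L ≃ₐ[↥(maximalRealSubfield L)] L) : L →+* L) (rfl : ((StdForm.antidiagonal 2).over L) = ((StdForm.antidiagonal 2).over L)))) *
          ((middleRootUnipotent hij hN (Multiplicative.ofAdd (traceZeroLine ↥(maximalRealSubfield L) L (IsCMField.complexConj L) hcδ hδ (((InfiniteAdeleRing.ringEquiv_mixedSpace ↥(maximalRealSubfield L)).symm s, b) : AdeleRing (𝓞 ↥(maximalRealSubfield L)) ↥(maximalRealSubfield L)))) : ↥(adelicUnipotent ↥(maximalRealSubfield L) L (IsCMField.complexConj L) 2)) : (quasiSplit (↥(maximalRealSubfield L)) L (IsCMField.complexConj L) 2).Adelic) * k) : ℝ) ^ z.re := by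
  obtain ⟨C₁, hC₁0, hC₁⟩ := exists_archSmooth_flatSectionU_const_cm_two_uniform L hij hN hcδ hδ 1 m R
  refine ⟨2 ^ m * Mφ * C₁, by positivity, fun z hz k hk b => ?_⟩
  obtain ⟨hφcd, hφb⟩ := hφsym k hk b
  obtain ⟨h1cd, h1b⟩ := hC₁ z hz k hk b
  have hfun : ((fun a : InfiniteAdeleRing ↥(maximalRealSubfield L) => flatSectionU φ z (((quasiSplit (↥(maximalRealSubfield L)) L (IsCMField.complexConj L) 2).toAdelic (weylLongU ((IsCMField.complexConj L : L ≃ₐ[↥(maximalRealSubfield L)] L) : L →+* L) (rfl : ((StdForm.antidiagonal 2).over L) = ((StdForm.antidiagonal 2).over L)))) *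
          ((middleRootUnipotent hij hN (Multiplicative.ofAdd (traceZeroLine ↥(maximalRealSubfield L) L (IsCMField.complexConj L) hcδ hδ ((a, b) : AdeleRing (𝓞 ↥(maximalRealSubfield L)) ↥(maximalRealSubfield L)))) : ↥(adelicUnipotent ↥(maximalRealSubfield L) L (IsCMField.complexConj L) 2)) : (quasiSplit (↥(maximalRealSubfield L)) L (IsCMField.complexConj L) 2).Adelic) * k)) ∘ (InfiniteAdeleRing.ringEquiv_mixedSpace ↥(maximalRealSubfield L)).symm) =
      fun s => ((fun a : InfiniteAdeleRing ↥(maximalRealSubfield L) => φ (((quasiSplit (↥(maximalRealSubfield L)) L (IsCMField.complexConj L) 2).toAdelic (weylLongU ((IsCMField.complexConj L : L ≃ₐ[↥(maximalRealSubfield L)] L) : L →+* L) (rfl : ((StdForm.antidiagonal 2).over L) = ((StdForm.antidiagonal 2).over L)))) *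
          ((middleRootUnipotent hij hN (Multiplicative.ofAdd (traceZeroLine ↥(maximalRealSubfield L) L (IsCMField.complexConj L) hcδ hδ ((a, b) : AdeleRing (𝓞 ↥(maximalRealSubfield L)) ↥(maximalRealSubfield L)))) : ↥(adelicUnipotent ↥(maximalRealSubfield L) L (IsCMField.complexConj L) 2)) : (quasiSplit (↥(maximalRealSubfield L)) L (IsCMField.complexConj L) 2).Adelic) * k)) ∘ (InfiniteAdeleRing.ringEquiv_mixedSpace ↥(maximalRealSubfield L)).symm) s * ((fun a : InfiniteAdeleRing ↥(maximalRealSubfield L) => flatSectionU (fun _ : (quasiSplit (↥(maximalRealSubfield L)) L (IsCMField.complexConj L) 2).Adelic => (1 : ℂ)) z (((quasiSplit (↥(maximalRealSubfield L)) L (IsCMField.complexConj L) 2).toAdelic (weylLongU ((IsCMField.complexConj L : L ≃ₐ[↥(maximalRealSubfield L)] L) : L →+* L) (rfl : ((StdForm.antidiagonal 2).over L) = ((StdForm.antidiagonal 2).over L)))) *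
          ((middleRootUnipotent hij hN (Multiplicative.ofAdd (traceZeroLine ↥(maximalRealSubfield L) L (IsCMField.complexConj L) hcδ hδ ((a, b) : AdeleRing (𝓞 ↥(maximalRealSubfield L)) ↥(maximalRealSubfield L)))) : ↥(adelicUnipotent ↥(maximalRealSubfield L) L (IsCMField.complexConj L) 2)) : (quasiSplit (↥(maximalRealSubfield L)) L (IsCMField.complexConj L) 2).Adelic) * k)) ∘ (InfiniteAdeleRing.ringEquiv_mixedSpace ↥(maximalRealSubfield L)).symm) s := by
    funext s
    simp only [Function.comp_apply, flatSectionU_apply, one_mul]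
  refine ⟨by rw [hfun]; exact hφcd.mul h1cd, fun j hj s => ?_⟩
  rw [hfun]
  refine (norm_iteratedFDeriv_mul_le_of_envelopes (𝔸 := ℂ) (e₁ := fun _ => (1 : ℝ)) hφcd h1cd (le_refl _) hMφ hC₁0 (fun _ => zero_le_one)
    (fun _ => Real.rpow_nonneg (NNReal.coe_nonneg _) _) (fun j hj x => by rw [mul_one]; exact hφb j hj x) h1b hj s).trans (le_of_eq ?_)
  ring

end Leibniz

/-! ## §2 The tensor socket: products of one-variable angular symbols of order zero -/

section Socket

/-- **THE LINE SYMBOL BOUND FROM A PRODUCT OF ANGULAR SYMBOLS** (the socket a `K_∞`-type leaf plugs).  Suppose along the big-cell line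
`φ(ι(w₀)·n(θ(ι⁻¹s, b))·k) = φ₀(b,k) · ∏_{w∣∞} u_w(s_{w|L⁺})` for all `k ∈ K_U`, `b`, `s`, with `‖φ₀(b,k)‖ ≤ M` and `C^m` one-variable symbols `u_w : ℝ → ℂ` of order zero,
`‖u_w⁽ʲ⁾(t)‖ ≤ M_u` (`j ≤ m`).  Then `hφsym` holds with `M_φ = M·(2^m·M_u)^{#{w}}` (★ (a3)₃ `norm_iteratedFDeriv_finset_prod_le_explicit` with envelopes `1`, ★
`norm_iteratedFDeriv_comp_form_le` along `ℓ_w = proj_{w|L⁺} ∘ fst`, `‖ℓ_w‖ ≤ 1`). [cite: HormanderALPDO1, §7.1] [cite: MoeglinWaldspurger1995, I.2.10–I.2.12] -/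
theorem lineSymbol_of_prod_angular {δ : L} (hcδ : IsCMField.complexConj L δ = -δ) (hδ : δ ≠ 0) (m : ℕ) {φ : (quasiSplit (↥(maximalRealSubfield L)) L (IsCMField.complexConj L) 2).Adelic → ℂ}
    {u : InfinitePlace L → ℝ → ℂ} {Mu : ℝ} (hMu : 0 ≤ Mu) (hu : ∀ w, ContDiff ℝ m (u w)) (hub : ∀ w, ∀ j : ℕ, j ≤ m → ∀ t : ℝ, ‖iteratedDeriv j (u w) t‖ ≤ Mu)
    {φ₀ : FiniteAdeleRing (𝓞 ↥(maximalRealSubfield L)) ↥(maximalRealSubfield L) → (quasiSplit (↥(maximalRealSubfield L)) L (IsCMField.complexConj L) 2).Adelic → ℂ} {M : ℝ} (hM : 0 ≤ M) (hφ₀ : ∀ b k, ‖φ₀ b k‖ ≤ M)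
    (hline : ∀ k ∈ ((standardMaximalCompactGL 2 L).comap (adelicVal ↥(maximalRealSubfield L) L (IsCMField.complexConj L) 2 ((StdForm.antidiagonal 2).over L)) : Subgroup (quasiSplit (↥(maximalRealSubfield L)) L (IsCMField.complexConj L) 2).Adelic), ∀ b : FiniteAdeleRing (𝓞 ↥(maximalRealSubfield L)) ↥(maximalRealSubfield L), ∀ s : mixedSpace ↥(maximalRealSubfield L),
      ((fun a : InfiniteAdeleRing ↥(maximalRealSubfield L) => φ (((quasiSplit (↥(maximalRealSubfield L)) L (IsCMField.complexConj L) 2).toAdelic (weylLongU ((IsCMField.complexConj L : L ≃ₐ[↥(maximalRealSubfield L)] L) : L →+* L) (rfl : ((StdForm.antidiagonal 2).over L) = ((StdForm.antidiagonal 2).over L)))) *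
          ((middleRootUnipotent hij hN (Multiplicative.ofAdd (traceZeroLine ↥(maximalRealSubfield L) L (IsCMField.complexConj L) hcδ hδ ((a, b) : AdeleRing (𝓞 ↥(maximalRealSubfield L)) ↥(maximalRealSubfield L)))) : ↥(adelicUnipotent ↥(maximalRealSubfield L) L (IsCMField.complexConj L) 2)) : (quasiSplit (↥(maximalRealSubfield L)) L (IsCMField.complexConj L) 2).Adelic) * k)) ∘ (InfiniteAdeleRing.ringEquiv_mixedSpace ↥(maximalRealSubfield L)).symm) s = φ₀ b k * ∏ w : InfinitePlace L, u w (s.1 ⟨w.comap (algebraMap ↥(maximalRealSubfield L) L), K2E1HeightBigCellLineFormulaU2.isReal_comap_maximalRealSubfield L w⟩)) :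
    ∀ k ∈ ((standardMaximalCompactGL 2 L).comap (adelicVal ↥(maximalRealSubfield L) L (IsCMField.complexConj L) 2 ((StdForm.antidiagonal 2).over L)) : Subgroup (quasiSplit (↥(maximalRealSubfield L)) L (IsCMField.complexConj L) 2).Adelic), ∀ b : FiniteAdeleRing (𝓞 ↥(maximalRealSubfield L)) ↥(maximalRealSubfield L),
      ContDiff ℝ m ((fun a : InfiniteAdeleRing ↥(maximalRealSubfield L) => φ (((quasiSplit (↥(maximalRealSubfield L)) L (IsCMField.complexConj L) 2).toAdelic (weylLongU ((IsCMField.complexConj L : L ≃ₐ[↥(maximalRealSubfield L)] L) : L →+* L) (rfl : ((StdForm.antidiagonal 2).over L) = ((StdForm.antidiagonal 2).over L)))) *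
          ((middleRootUnipotent hij hN (Multiplicative.ofAdd (traceZeroLine ↥(maximalRealSubfield L) L (IsCMField.complexConj L) hcδ hδ ((a, b) : AdeleRing (𝓞 ↥(maximalRealSubfield L)) ↥(maximalRealSubfield L)))) : ↥(adelicUnipotent ↥(maximalRealSubfield L) L (IsCMField.complexConj L) 2)) : (quasiSplit (↥(maximalRealSubfield L)) L (IsCMField.complexConj L) 2).Adelic) * k)) ∘ (InfiniteAdeleRing.ringEquiv_mixedSpace ↥(maximalRealSubfield L)).symm) ∧
      ∀ j : ℕ, j ≤ m → ∀ s : mixedSpace ↥(maximalRealSubfield L), ‖iteratedFDeriv ℝ j ((fun a : InfiniteAdeleRing ↥(maximalRealSubfield L) => φ (((quasiSplit (↥(maximalRealSubfield L)) L (IsCMField.complexConj L) 2).toAdelic (weylLongU ((IsCMField.complexConj L : L ≃ₐ[↥(maximalRealSubfield L)] L) : L →+* L) (rfl : ((StdForm.antidiagonal 2).over L) = ((StdForm.antidiagonal 2).over L)))) *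
          ((middleRootUnipotent hij hN (Multiplicative.ofAdd (traceZeroLine ↥(maximalRealSubfield L) L (IsCMField.complexConj L) hcδ hδ ((a, b) : AdeleRing (𝓞 ↥(maximalRealSubfield L)) ↥(maximalRealSubfield L)))) : ↥(adelicUnipotent ↥(maximalRealSubfield L) L (IsCMField.complexConj L) 2)) : (quasiSplit (↥(maximalRealSubfield L)) L (IsCMField.complexConj L) 2).Adelic) * k)) ∘ (InfiniteAdeleRing.ringEquiv_mixedSpace ↥(maximalRealSubfield L)).symm) s‖ ≤ M * (2 ^ m * Mu) ^ (Finset.univ : Finset (InfinitePlace L)).card := by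
  intro k hk b
  -- the coordinate forms and the pulled-back symbols
  set ℓ : InfinitePlace L → (mixedSpace ↥(maximalRealSubfield L) →L[ℝ] ℝ) := fun w =>
    (ContinuousLinearMap.proj (R := ℝ) (φ := fun _ : {v : InfinitePlace ↥(maximalRealSubfield L) // v.IsReal} => ℝ) ⟨w.comap (algebraMap ↥(maximalRealSubfield L) L), K2E1HeightBigCellLineFormulaU2.isReal_comap_maximalRealSubfield L w⟩).comp
      (ContinuousLinearMap.fst ℝ ({v : InfinitePlace ↥(maximalRealSubfield L) // v.IsReal} → ℝ) ({v : InfinitePlace ↥(maximalRealSubfield L) // v.IsComplex} → ℂ)) with hℓ_def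
  have hℓ : ∀ w, ‖ℓ w‖ ≤ 1 := fun w => norm_proj_comp_fst_le_one ↥(maximalRealSubfield L) _
  have hℓs : ∀ w (s : mixedSpace ↥(maximalRealSubfield L)), ℓ w s = s.1 ⟨w.comap (algebraMap ↥(maximalRealSubfield L) L), K2E1HeightBigCellLineFormulaU2.isReal_comap_maximalRealSubfield L w⟩ := fun w s => rfl
  set g : InfinitePlace L → mixedSpace ↥(maximalRealSubfield L) → ℂ := fun w => u w ∘ ℓ w with hg_def
  have hg : ∀ w ∈ (Finset.univ : Finset (InfinitePlace L)), ContDiff ℝ (m : ℕ∞) (g w) := fun w _ => (hu w).comp (ℓ w).contDiff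
  have he : ∀ w ∈ (Finset.univ : Finset (InfinitePlace L)), ∀ s : mixedSpace ↥(maximalRealSubfield L), 0 ≤ (fun (_ : InfinitePlace L) (_ : mixedSpace ↥(maximalRealSubfield L)) => (1 : ℝ)) w s :=
    fun _ _ _ => zero_le_one
  have hb : ∀ w ∈ (Finset.univ : Finset (InfinitePlace L)), ∀ j ≤ m, ∀ s, ‖iteratedFDeriv ℝ j (g w) s‖ ≤ Mu * (fun (_ : InfinitePlace L) (_ : mixedSpace ↥(maximalRealSubfield L)) => (1 : ℝ)) w s := by
    intro w _ j hj s
    have hjm : (j : WithTop ℕ∞) ≤ (m : ℕ∞) := by exact_mod_cast hj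
    rw [mul_one]
    exact (norm_iteratedFDeriv_comp_form_le (hu w) (ℓ w) (hℓ w) s hjm).trans (hub w j hj (ℓ w s))
  obtain ⟨hprod, hbound⟩ := norm_iteratedFDeriv_finset_prod_le_explicit (Finset.univ : Finset (InfinitePlace L)) hg (le_refl _) hMu he hb
  have hfun : ((fun a : InfiniteAdeleRing ↥(maximalRealSubfield L) => φ (((quasiSplit (↥(maximalRealSubfield L)) L (IsCMField.complexConj L) 2).toAdelic (weylLongU ((IsCMField.complexConj L : L ≃ₐ[↥(maximalRealSubfield L)] L) : L →+* L) (rfl : ((StdForm.antidiagonal 2).over L) = ((StdForm.antidiagonal 2).over L)))) *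
          ((middleRootUnipotent hij hN (Multiplicative.ofAdd (traceZeroLine ↥(maximalRealSubfield L) L (IsCMField.complexConj L) hcδ hδ ((a, b) : AdeleRing (𝓞 ↥(maximalRealSubfield L)) ↥(maximalRealSubfield L)))) : ↥(adelicUnipotent ↥(maximalRealSubfield L) L (IsCMField.complexConj L) 2)) : (quasiSplit (↥(maximalRealSubfield L)) L (IsCMField.complexConj L) 2).Adelic) * k)) ∘ (InfiniteAdeleRing.ringEquiv_mixedSpace ↥(maximalRealSubfield L)).symm) = (φ₀ b k) • fun s => ∏ w, g w s := by
    funext s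
    rw [hline k hk b s, Pi.smul_apply, smul_eq_mul]
    rfl
  have hcd : ContDiff ℝ m ((φ₀ b k) • fun s => ∏ w, g w s) := hprod.const_smul (φ₀ b k)
  refine ⟨by rw [hfun]; exact hcd, fun j hj s => ?_⟩
  rw [hfun, iteratedFDeriv_const_smul_apply ((hprod.of_le (by exact_mod_cast hj)).contDiffAt), _root_.norm_smul]
  have h := hbound j hj s
  rw [Finset.prod_const_one, mul_one] at h
  exact mul_le_mul (hφ₀ b k) h (norm_nonneg _) hM

end Socket

/-! ## §3 The `K_∞`-spherical finite-type case -/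

section Spherical

/-- **`K_∞`-SPHERICAL, ARBITRARY FINITE TYPE**: if the line function of `φ` is constant on `mixedSpace L⁺` (`φ(ι(w₀)·n(θ(ι⁻¹s,b))·k) = φ(ι(w₀)·n(θ(ι⁻¹s′,b))·k)`, e.g. `φ` factors through the
finite component) and `‖φ‖ ≤ M`, then `hφsym` holds with `M_φ = M` (the line function is constant: `Dʲ = 0` for `j ≥ 1`).  With §1 this extends ★ (a3)₂ from `φ ≡ φ₀` to every
finite-type section that is spherical at `∞`. [cite: MoeglinWaldspurger1995, I.2.10–I.2.12] -/
theorem lineSymbol_of_archConstant {δ : L} (hcδ : IsCMField.complexConj L δ = -δ) (hδ : δ ≠ 0) (m : ℕ) {φ : (quasiSplit (↥(maximalRealSubfield L)) L (IsCMField.complexConj L) 2).Adelic → ℂ} {M : ℝ} (hM : ∀ g, ‖φ g‖ ≤ M)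
    (hconst : ∀ k ∈ ((standardMaximalCompactGL 2 L).comap (adelicVal ↥(maximalRealSubfield L) L (IsCMField.complexConj L) 2 ((StdForm.antidiagonal 2).over L)) : Subgroup (quasiSplit (↥(maximalRealSubfield L)) L (IsCMField.complexConj L) 2).Adelic), ∀ b : FiniteAdeleRing (𝓞 ↥(maximalRealSubfield L)) ↥(maximalRealSubfield L), ∀ s s' : mixedSpace ↥(maximalRealSubfield L),
      ((fun a : InfiniteAdeleRing ↥(maximalRealSubfield L) => φ (((quasiSplit (↥(maximalRealSubfield L)) L (IsCMField.complexConj L) 2).toAdelic (weylLongU ((IsCMField.complexConj L : L ≃ₐ[↥(maximalRealSubfield L)] L) : L →+* L) (rfl : ((StdForm.antidiagonal 2).over L) = ((StdForm.antidiagonal 2).over L)))) *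
          ((middleRootUnipotent hij hN (Multiplicative.ofAdd (traceZeroLine ↥(maximalRealSubfield L) L (IsCMField.complexConj L) hcδ hδ ((a, b) : AdeleRing (𝓞 ↥(maximalRealSubfield L)) ↥(maximalRealSubfield L)))) : ↥(adelicUnipotent ↥(maximalRealSubfield L) L (IsCMField.complexConj L) 2)) : (quasiSplit (↥(maximalRealSubfield L)) L (IsCMField.complexConj L) 2).Adelic) * k)) ∘ (InfiniteAdeleRing.ringEquiv_mixedSpace ↥(maximalRealSubfield L)).symm) s = ((fun a : InfiniteAdeleRing ↥(maximalRealSubfield L) => φ (((quasiSplit (↥(maximalRealSubfield L)) L (IsCMField.complexConj L) 2).toAdelic (weylLongU ((IsCMField.complexConj L : L ≃ₐ[↥(maximalRealSubfield L)] L) : L →+* L) (rfl : ((StdForm.antidiagonal 2).over L) = ((StdForm.antidiagonal 2).over L)))) *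
          ((middleRootUnipotent hij hN (Multiplicative.ofAdd (traceZeroLine ↥(maximalRealSubfield L) L (IsCMField.complexConj L) hcδ hδ ((a, b) : AdeleRing (𝓞 ↥(maximalRealSubfield L)) ↥(maximalRealSubfield L)))) : ↥(adelicUnipotent ↥(maximalRealSubfield L) L (IsCMField.complexConj L) 2)) : (quasiSplit (↥(maximalRealSubfield L)) L (IsCMField.complexConj L) 2).Adelic) * k)) ∘ (InfiniteAdeleRing.ringEquiv_mixedSpace ↥(maximalRealSubfield L)).symm) s') :
    ∀ k ∈ ((standardMaximalCompactGL 2 L).comap (adelicVal ↥(maximalRealSubfield L) L (IsCMField.complexConj L) 2 ((StdForm.antidiagonal 2).over L)) : Subgroup (quasiSplit (↥(maximalRealSubfield L)) L (IsCMField.complexConj L) 2).Adelic), ∀ b : FiniteAdeleRing (𝓞 ↥(maximalRealSubfield L)) ↥(maximalRealSubfield L),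
      ContDiff ℝ m ((fun a : InfiniteAdeleRing ↥(maximalRealSubfield L) => φ (((quasiSplit (↥(maximalRealSubfield L)) L (IsCMField.complexConj L) 2).toAdelic (weylLongU ((IsCMField.complexConj L : L ≃ₐ[↥(maximalRealSubfield L)] L) : L →+* L) (rfl : ((StdForm.antidiagonal 2).over L) = ((StdForm.antidiagonal 2).over L)))) *
          ((middleRootUnipotent hij hN (Multiplicative.ofAdd (traceZeroLine ↥(maximalRealSubfield L) L (IsCMField.complexConj L) hcδ hδ ((a, b) : AdeleRing (𝓞 ↥(maximalRealSubfield L)) ↥(maximalRealSubfield L)))) : ↥(adelicUnipotent ↥(maximalRealSubfield L) L (IsCMField.complexConj L) 2)) : (quasiSplit (↥(maximalRealSubfield L)) L (IsCMField.complexConj L) 2).Adelic) * k)) ∘ (InfiniteAdeleRing.ringEquiv_mixedSpace ↥(maximalRealSubfield L)).symm) ∧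
      ∀ j : ℕ, j ≤ m → ∀ s : mixedSpace ↥(maximalRealSubfield L), ‖iteratedFDeriv ℝ j ((fun a : InfiniteAdeleRing ↥(maximalRealSubfield L) => φ (((quasiSplit (↥(maximalRealSubfield L)) L (IsCMField.complexConj L) 2).toAdelic (weylLongU ((IsCMField.complexConj L : L ≃ₐ[↥(maximalRealSubfield L)] L) : L →+* L) (rfl : ((StdForm.antidiagonal 2).over L) = ((StdForm.antidiagonal 2).over L)))) *
          ((middleRootUnipotent hij hN (Multiplicative.ofAdd (traceZeroLine ↥(maximalRealSubfield L) L (IsCMField.complexConj L) hcδ hδ ((a, b) : AdeleRing (𝓞 ↥(maximalRealSubfield L)) ↥(maximalRealSubfield L)))) : ↥(adelicUnipotent ↥(maximalRealSubfield L) L (IsCMField.complexConj L) 2)) : (quasiSplit (↥(maximalRealSubfield L)) L (IsCMField.complexConj L) 2).Adelic) * k)) ∘ (InfiniteAdeleRing.ringEquiv_mixedSpace ↥(maximalRealSubfield L)).symm) s‖ ≤ M := by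
  intro k hk b
  have hfun : ((fun a : InfiniteAdeleRing ↥(maximalRealSubfield L) => φ (((quasiSplit (↥(maximalRealSubfield L)) L (IsCMField.complexConj L) 2).toAdelic (weylLongU ((IsCMField.complexConj L : L ≃ₐ[↥(maximalRealSubfield L)] L) : L →+* L) (rfl : ((StdForm.antidiagonal 2).over L) = ((StdForm.antidiagonal 2).over L)))) *
          ((middleRootUnipotent hij hN (Multiplicative.ofAdd (traceZeroLine ↥(maximalRealSubfield L) L (IsCMField.complexConj L) hcδ hδ ((a, b) : AdeleRing (𝓞 ↥(maximalRealSubfield L)) ↥(maximalRealSubfield L)))) : ↥(adelicUnipotent ↥(maximalRealSubfield L) L (IsCMField.complexConj L) 2)) : (quasiSplit (↥(maximalRealSubfield L)) L (IsCMField.complexConj L) 2).Adelic) * k)) ∘ (InfiniteAdeleRing.ringEquiv_mixedSpace ↥(maximalRealSubfield L)).symm) = fun _ => ((fun a : InfiniteAdeleRing ↥(maximalRealSubfield L) => φ (((quasiSplit (↥(maximalRealSubfield L)) L (IsCMField.complexConj L) 2).toAdelic (weylLongU ((IsCMField.complexConj L : L ≃ₐ[↥(maximalRealSubfield L)] L)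 : L →+* L) (rfl : ((StdForm.antidiagonal 2).over L) = ((StdForm.antidiagonal 2).over L)))) *
          ((middleRootUnipotent hij hN (Multiplicative.ofAdd (traceZeroLine ↥(maximalRealSubfield L) L (IsCMField.complexConj L) hcδ hδ ((a, b) : AdeleRing (𝓞 ↥(maximalRealSubfield L)) ↥(maximalRealSubfield L)))) : ↥(adelicUnipotent ↥(maximalRealSubfield L) L (IsCMField.complexConj L) 2)) : (quasiSplit (↥(maximalRealSubfield L)) L (IsCMField.complexConj L) 2).Adelic) * k)) ∘ (InfiniteAdeleRing.ringEquiv_mixedSpace ↥(maximalRealSubfield L)).symm) 0 := funext fun s => hconst k hk b s 0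
  have h0 : 0 ≤ M := (norm_nonneg _).trans (hM 1)
  refine ⟨by rw [hfun]; exact contDiff_const, fun j hj s => ?_⟩
  rw [hfun]
  rcases Nat.eq_zero_or_pos j with rfl | hjpos
  · rw [norm_iteratedFDeriv_zero]
    exact hM _
  · rw [iteratedFDeriv_const_of_ne (𝕜 := ℝ) hjpos.ne', Pi.zero_apply, norm_zero]
    exact h0

end Spherical

/-! ## §4 A concrete angular symbol of order zero: `v_c(s)ⁿ`, `v_c(s) = (1 + i c s)·(1 + c²s²)^{−1/2}` (`|v_c| = 1`) -/

section Angular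

open Summit.HodgeConjecture.HodgeConjecture.Cruxes.H413.K2E1OnePlusSqPowerSymbol (contDiff_onePlusSqPow exists_norm_iteratedFDeriv_le norm_onePlusSqPow)

/-- The affine factor `a(s) = 1 + i c s` has derivative `i c`. [folklore] -/
theorem hasDerivAt_affineI (c s : ℝ) : HasDerivAt (fun s : ℝ => (1 : ℂ) + Complex.I * (c : ℂ) * (s : ℂ)) (Complex.I * (c : ℂ)) s := by
  have h : HasDerivAt (fun y : ℝ => ((id y : ℝ) : ℂ)) (((1 : ℝ)) : ℂ) s := (hasDerivAt_id s).ofReal_comp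
  have h2 := (h.const_mul (Complex.I * (c : ℂ))).const_add (1 : ℂ)
  simp only [Complex.ofReal_one, mul_one] at h2
  exact h2

/-- `a′ ≡ i c`, hence `iteratedDeriv 1 a = i c` and `iteratedDeriv (k+2) a = 0`. [folklore] -/
theorem deriv_affineI (c : ℝ) : deriv (fun s : ℝ => (1 : ℂ) + Complex.I * (c : ℂ) * (s : ℂ)) = fun _ => Complex.I * (c : ℂ) :=
  funext fun s => (hasDerivAt_affineI c s).deriv

/-- `‖a(s)‖ = √(1 + c²s²)`. [folklore] -/
theorem norm_affineI (c s : ℝ) : ‖(1 : ℂ) + Complex.I * (c : ℂ) * (s : ℂ)‖ = Real.sqrt (1 + c ^ 2 * s ^ 2) := by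
  rw [Complex.norm_eq_sqrt_sq_add_sq]
  congr 1
  simp only [Complex.add_re, Complex.one_re, Complex.mul_re, Complex.I_re, Complex.ofReal_re, Complex.I_im, Complex.ofReal_im, Complex.add_im, Complex.one_im,
    Complex.mul_im]
  ring

/-- **The derivatives of the affine factor are dominated by `max 1 |c| · √(1 + c²s²)`** (`j` arbitrary). [folklore] -/
theorem norm_iteratedFDeriv_affineI_le (c : ℝ) (j : ℕ) (s : ℝ) :
    ‖iteratedFDeriv ℝ j (fun s : ℝ => (1 : ℂ) + Complex.I * (c : ℂ) * (s : ℂ)) s‖ ≤ max 1 |c| * Real.sqrt (1 + c ^ 2 * s ^ 2) := by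
  have h1 : (1 : ℝ) ≤ Real.sqrt (1 + c ^ 2 * s ^ 2) := (Real.le_sqrt' zero_lt_one).2 (by nlinarith [sq_nonneg (c * s)])
  rw [norm_iteratedFDeriv_eq_norm_iteratedDeriv]
  rcases j with _ | j
  · rw [iteratedDeriv_zero, norm_affineI]
    exact le_mul_of_one_le_left (Real.sqrt_nonneg _) (le_max_left _ _)
  · rw [iteratedDeriv_succ', deriv_affineI]
    rcases j with _ | j
    · rw [iteratedDeriv_zero, norm_mul, Complex.norm_I, one_mul, Complex.norm_real, Real.norm_eq_abs]
      exact (le_max_right 1 |c|).trans (le_mul_of_one_le_right (le_trans zero_le_one (le_max_left _ _)) h1)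
    · rw [iteratedDeriv_const, if_neg (Nat.succ_ne_zero j), norm_zero]
      positivity

/-- `a` is smooth. [folklore] -/
theorem contDiff_affineI (c : ℝ) {N : WithTop ℕ∞} : ContDiff ℝ N (fun s : ℝ => (1 : ℂ) + Complex.I * (c : ℂ) * (s : ℂ)) :=
  contDiff_const.add (contDiff_const.mul Complex.ofRealCLM.contDiff)

/-- **`|v_c(s)| = 1`**: `v_c(s) = (1 + i c s)(1 + c²s²)^{−1/2}` is the unit vector `e^{i·arctan(cs)}` — the angular factor of the last row `(1, i c s)` of `ι(w₀)·n(θ s)` at a complex place.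
[cite: Garrett2018, §2.2] -/
theorem norm_angular_eq_one (c s : ℝ) : ‖(1 + Complex.I * (c : ℂ) * (s : ℂ)) * ((((1 + c ^ 2 * s ^ 2 : ℝ)) : ℂ) ^ (-(((1 / 2 : ℝ)) : ℂ)))‖ = 1 := by
  have hq : 0 < 1 + c ^ 2 * s ^ 2 := by positivity
  rw [norm_mul, norm_affineI, norm_onePlusSqPow (sq_nonneg c), Complex.ofReal_re, Real.sqrt_eq_rpow, ← Real.rpow_add hq]
  norm_num

/-- **THE ANGULAR SYMBOL IS OF ORDER ZERO**: for `c ≠ 0` and `n, m ∈ ℕ`, `s ↦ v_c(s)ⁿ` is `C^m` and ALL its derivatives of order `≤ m` are bounded by ONE constant `C(c, n, m)`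
(Leibniz ★ `norm_iteratedFDeriv_mul_le_of_envelopes` with the envelopes `√(1+c²s²)` of the affine factor and `(1+c²s²)^{−1/2}` of ★ (a1) `exists_norm_iteratedFDeriv_le`, product `1`;
powers by ★ (a3)₃ `norm_iteratedFDeriv_finset_prod_le_explicit` with envelopes `1`).  This is the `u_w` of §2 for a weight with `p − q = n` (conjugate for `n < 0`).
[cite: HormanderALPDO1, §7.1] [cite: MoeglinWaldspurger1995, I.2.10–I.2.12] -/
theorem angularPow_contDiff_and_exists_norm_iteratedDeriv_le {c : ℝ} (hc : c ≠ 0) (n m : ℕ) :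
    ContDiff ℝ m (fun s : ℝ => ((1 + Complex.I * (c : ℂ) * (s : ℂ)) * ((((1 + c ^ 2 * s ^ 2 : ℝ)) : ℂ) ^ (-(((1 / 2 : ℝ)) : ℂ)))) ^ n) ∧
    ∃ C : ℝ, 0 ≤ C ∧ ∀ j : ℕ, j ≤ m → ∀ s : ℝ, ‖iteratedDeriv j (fun s : ℝ => ((1 + Complex.I * (c : ℂ) * (s : ℂ)) * ((((1 + c ^ 2 * s ^ 2 : ℝ)) : ℂ) ^ (-(((1 / 2 : ℝ)) : ℂ)))) ^ n) s‖ ≤ C := by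
  have hc2 : 0 < c ^ 2 := by positivity
  -- (1) the two factors and their envelopes
  have ha : ContDiff ℝ (m : ℕ∞) (fun s : ℝ => (1 : ℂ) + Complex.I * (c : ℂ) * (s : ℂ)) := contDiff_affineI c
  have hp : ContDiff ℝ (m : ℕ∞) (fun s : ℝ => ((((1 + c ^ 2 * s ^ 2 : ℝ)) : ℂ) ^ (-(((1 / 2 : ℝ)) : ℂ)))) := contDiff_onePlusSqPow hc2.le _
  choose C hC0 hC using fun j : ℕ => exists_norm_iteratedFDeriv_le hc2 ((((1 / 2 : ℝ)) : ℂ)) j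
  set B : ℝ := ∑ j ∈ Finset.range (m + 1), C j with hB_def
  have hB0 : 0 ≤ B := Finset.sum_nonneg fun j _ => hC0 j
  have hCle : ∀ j ≤ m, C j ≤ B := fun j hj => Finset.single_le_sum (f := fun j => C j) (fun i _ => hC0 i) (Finset.mem_range.2 (Nat.lt_succ_of_le hj))
  have henv : ∀ s : ℝ, Real.sqrt (1 + c ^ 2 * s ^ 2) * (1 + c ^ 2 * s ^ 2) ^ (-((((1 / 2 : ℝ)) : ℂ)).re) = 1 := by
    intro s
    have hq : 0 < 1 + c ^ 2 * s ^ 2 := by positivity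
    rw [Complex.ofReal_re, Real.sqrt_eq_rpow, ← Real.rpow_add hq]
    norm_num
  have hv : ∀ j ≤ m, ∀ s : ℝ, ‖iteratedFDeriv ℝ j (fun s : ℝ => (1 + Complex.I * (c : ℂ) * (s : ℂ)) * ((((1 + c ^ 2 * s ^ 2 : ℝ)) : ℂ) ^ (-(((1 / 2 : ℝ)) : ℂ)))) s‖ ≤ 2 ^ m * max 1 |c| * B := by
    intro j hj s
    have h := norm_iteratedFDeriv_mul_le_of_envelopes (𝔸 := ℂ) (e₁ := fun s : ℝ => Real.sqrt (1 + c ^ 2 * s ^ 2)) (e₂ := fun s : ℝ => (1 + c ^ 2 * s ^ 2) ^ (-((((1 / 2 : ℝ)) : ℂ)).re))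
      ha hp (le_refl _) (le_trans zero_le_one (le_max_left 1 |c|)) hB0 (fun s => Real.sqrt_nonneg _) (fun s => Real.rpow_nonneg (by positivity) _)
      (fun j _ s => norm_iteratedFDeriv_affineI_le c j s) (fun j hj s => (hC j s).trans (mul_le_mul_of_nonneg_right (hCle j hj) (Real.rpow_nonneg (by positivity) _))) hj s
    rw [henv s, mul_one] at h
    exact h
  -- (2) the power as a product over `Finset.range n`
  have hvcd : ContDiff ℝ (m : ℕ∞) (fun s : ℝ => (1 + Complex.I * (c : ℂ) * (s : ℂ)) * ((((1 + c ^ 2 * s ^ 2 : ℝ)) : ℂ) ^ (-(((1 / 2 : ℝ)) : ℂ)))) := ha.mul hp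
  obtain ⟨hprod, hbound⟩ := norm_iteratedFDeriv_finset_prod_le_explicit (X := ℝ) (𝔸 := ℂ) (Finset.range n) (g := fun _ : ℕ => (fun s : ℝ => (1 + Complex.I * (c : ℂ) * (s : ℂ)) * ((((1 + c ^ 2 * s ^ 2 : ℝ)) : ℂ) ^ (-(((1 / 2 : ℝ)) : ℂ))))) (e := fun (_ : ℕ) (_ : ℝ) => (1 : ℝ))
    (fun _ _ => hvcd) (le_refl _) (by positivity : (0 : ℝ) ≤ 2 ^ m * max 1 |c| * B) (fun _ _ _ => zero_le_one) (fun _ _ j hj s => by rw [mul_one]; exact hv j hj s)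
  have hfun : (fun s : ℝ => ((1 + Complex.I * (c : ℂ) * (s : ℂ)) * ((((1 + c ^ 2 * s ^ 2 : ℝ)) : ℂ) ^ (-(((1 / 2 : ℝ)) : ℂ)))) ^ n) = fun s => ∏ _i ∈ Finset.range n, (fun s : ℝ => (1 + Complex.I * (c : ℂ) * (s : ℂ)) * ((((1 + c ^ 2 * s ^ 2 : ℝ)) : ℂ) ^ (-(((1 / 2 : ℝ)) : ℂ)))) s := by
    funext s
    rw [Finset.prod_const, Finset.card_range]
  refine ⟨by rw [hfun]; exact hprod, (2 ^ m * (2 ^ m * max 1 |c| * B)) ^ (Finset.range n).card, by positivity, fun j hj s => ?_⟩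
  rw [← norm_iteratedFDeriv_eq_norm_iteratedDeriv, hfun]
  have h := hbound j hj s
  rw [Finset.prod_const_one, mul_one] at h
  exact h

end Angular

end Summit.HodgeConjecture.HodgeConjecture.Cruxes.H413.K2E1KFiniteArchSmoothU2

end
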